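import Summits.QuantumFields.YangMills.Theorems.BalabanUVNodesPortS1Sect4AmbientExtension
import Literature.MathematicalPhysics.QuantumFieldTheory.Balaban1983to89.B12WardSecond415
import Literature.MathematicalPhysics.QuantumFieldTheory.Balaban1983to89.B12Schur433
import Literature.Algebra.Lie.SpecialUnitarySimple

/-!
# NODE O port, row PT-A-2 S4-B∕S4-C — FIRST PAYOFF OF THE QUATERNIONIC AMBIENT EXTENSION: [Balaban1987RG1] (4.15)₂ p. 284 (the SECOND Ward–Takahashi identity at `B = 0`,
# third derivatives) and p. 289's infinitesimal `Ad`-invariance of `𝐄^{(2)}` ((4.32)–(4.33)) FOR THE RECORD'S CHART `B ↦ 𝓝_{k+1}(exp ρ₈B)`, by instantiating the B12 lineage's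
# AMBIENT-typed `B12WardSecond415.third_chart_apply_grad_eq_zero_of_isSemisimple` ∕ `hessian_chart_ad_invariant_of_isSemisimple` at the extension `ℰ′` of FILE `…Sect4AmbientExtension`

CITATION HEADER.  [I] = [Balaban1987RG1]: (4.7)–(4.11) pp. 282–283, (4.13)–(4.15) p. 284, (4.32)–(4.33) p. 289.  Porter PT-A-2 (`ymgap-nodeO-port-PTA-2`), `--supports stmt-QuantumFields-27930
--as helper`.  REUSED BY NAME: `…Sect4AmbientExtension.exists_ambient_extension_recordTermsAx`, `B12WardSecond415.{third_chart_apply_grad_eq_zero_of_isSemisimple,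
hessian_chart_ad_invariant_of_isSemisimple}`, `CompactKillingForm.su` (𝔰𝔲(2) semisimple, `instIsSemisimpleSu`), the chart of record `suChartMap 2`.
WHAT IS PROVED (0 sorry, 0 def): `exists_lieEquiv_su_thetaFill` (the record's direction space IS 𝔰𝔲(2): a linear equivalence `eV` with `↑(eV a) = ρ₈ a`, hence
`ρ₈(eV⁻¹⁅eV a, eV b⁆) = ρ₈a ρ₈b − ρ₈b ρ₈a`); ★★ `wardSecond_recordTermsAx` ((4.15)₂ at the record, volume `K`, from the on-domain gauge invariance of `𝓝_{k+1}` + `C³` at `0` of the chart);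
★ `hessian_recordTermsAx_ad_invariant` (p. 289: `D²f(0)(u, [l, v]) + D²f(0)(v, [l, u]) = 0`); (v2) ★★ `hessian_recordTermsAx_eq_sum_scalar_kernel` ((4.32)–(4.34): the Hessian of the
record's chart is `Σ κ(eV u, eV w)·E`, ONE scalar kernel — `B12Schur433.hessian_chart_eq_sum_scalar_kernel_killing` at the extension).
HONEST FRAMING.  Instantiation bookkeeping; nothing of Bałaban's estimates asserted, ported or discharged; 27930 signed-open (⁸-Ax-LR4), no claim held; finite 𝕋⁴ at fixed ε — NOT continuum∕OS∕Clay;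
the Yang–Mills mass gap is NOT proved by any of this.
-/

noncomputable section

open scoped Matrix.Norms.L2Operator Topology

namespace Summit.QuantumFields.YangMills.Theorems.BalabanUVNodesPortS1

open Filter Matrix
open NormedSpace (exp)
open Literature.Algebra.Lie.CompactKillingForm (su mem_su_iff)
open Literature.MathematicalPhysics.QuantumFieldTheory.Balaban1983to89
open Literature.MathematicalPhysics.QuantumFieldTheory.Balaban1983to89.Node00
open Literature.MathematicalPhysics.QuantumFieldTheory.GawedzkiKupiainen1985.PeriodicGleason (unitVec)
open T4Continuum (T4Family)
open Summit.QuantumFields.YangMills.Theorems.K0RecordFormatNames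
open Literature.MathematicalPhysics.QuantumFieldTheory.Balaban1983to89.B12PolarizationTensor120 (expChart expChart_apply)
open Literature.MathematicalPhysics.QuantumFieldTheory.Balaban1983to89.B12WardSecond415 (third_chart_apply_grad_eq_zero_of_isSemisimple hessian_chart_ad_invariant_of_isSemisimple)
open GaugeField (gaugeAct)

variable (F : T4Family) (a₀ ε₂₉ : ℝ)

/-- **The record's direction space IS 𝔰𝔲(2)**: a real-linear equivalence `eV : θ.Vβ ≃ 𝔰𝔲(2)` with `↑(eV a) = ρ₈ a`; consequently `ρ₈` intertwines the transported bracket with the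
commutator. [cite: Balaban1987RG1, p.252 («𝐠 … an algebra of complex matrices»), p.264 (before (1.20)); Hall2015, Example 7.3] -/
theorem exists_lieEquiv_su_thetaFill :
    letI θ := thetaFill F a₀ ε₂₉; letI := θ.instVβ₁; letI := θ.instVβ₂
    ∃ eV : θ.Vβ ≃ₗ[ℝ] su (Fin 2), (∀ a, ((eV a : su (Fin 2)) : MatA 2) = θ.ρ8 a) ∧
      ∀ a b : θ.Vβ, θ.ρ8 (eV.symm ⁅eV a, eV b⁆) = θ.ρ8 a * θ.ρ8 b - θ.ρ8 b * θ.ρ8 a := by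
  letI θ := thetaFill F a₀ ε₂₉; letI := θ.instVβ₁; letI := θ.instVβ₂
  have hρ : (θ.ρ8 : θ.Vβ → MatA 2) = (suChartMap 2 : (Fin (suChartDim 2) → ℝ) → MatA 2) := rfl
  have hmem : ∀ x : θ.Vβ, θ.ρ8 x ∈ su (Fin 2) := fun x => mem_su_iff.2 (by rw [congrFun hρ x]; exact suChartMap_mem 2 x)
  let f : θ.Vβ →ₗ[ℝ] su (Fin 2) :=
    { toFun := fun x => ⟨θ.ρ8 x, hmem x⟩
      map_add' := fun x y => Subtype.ext (by simp only [map_add]; rfl)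
      map_smul' := fun c x => Subtype.ext (by simp only [map_smul, RingHom.id_apply]; rfl) }
  have hf : ∀ x, ((f x : su (Fin 2)) : MatA 2) = θ.ρ8 x := fun _ => rfl
  have hinj : Function.Injective f := fun x y hxy => by
    have h' : θ.ρ8 x = θ.ρ8 y := by rw [← hf, ← hf, hxy]
    rw [congrFun hρ x, congrFun hρ y] at h'
    exact suChartMap_injective 2 h'
  have hsurj : Function.Surjective f := fun X => by
    obtain ⟨h1, h2⟩ := mem_su_iff.1 X.2
    obtain ⟨x, hx⟩ := suChartMap_onto 2 (X : MatA 2) h1 h2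
    exact ⟨x, Subtype.ext (by rw [hf, congrFun hρ x]; exact hx)⟩
  let eV : θ.Vβ ≃ₗ[ℝ] su (Fin 2) := LinearEquiv.ofBijective f ⟨hinj, hsurj⟩
  have heV : ∀ a, ((eV a : su (Fin 2)) : MatA 2) = θ.ρ8 a := fun _ => rfl
  refine ⟨eV, heV, fun a b => ?_⟩
  have h : θ.ρ8 (eV.symm ⁅eV a, eV b⁆) = (((eV (eV.symm ⁅eV a, eV b⁆)) : su (Fin 2)) : MatA 2) := (heV _).symm
  rw [h, LinearEquiv.apply_symm_apply]
  show ((eV a : su (Fin 2)) : MatA 2) * ((eV b : su (Fin 2)) : MatA 2) - ((eV b : su (Fin 2)) : MatA 2) * ((eV a : su (Fin 2)) : MatA 2) = _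
  rw [heV, heV]

/-- **★★ (4.15)₂ AT THE RE-CENTRED RECORD, VOLUME `K`** — «⟨(δ³∕δB³)𝐄(1), −∂λ, B₁, B₂⟩ + ⟨(δ²∕δB²)𝐄(1), i ad_{λ₋}B₂ − ½ i ad_{B₂}∂λ, B₁⟩ + (B₁↔B₂) = 0» for the record's chart
`f(B) = 𝓝_{k+1}(exp ρ₈B)`: from `𝓝_{k+1}(W^w) = 𝓝_{k+1}(W)` for every lattice gauge transformation and every `ε₁`-small `W`, and `C³` of the chart at `0` — the B12 lineage's ambient
`third_chart_apply_grad_eq_zero_of_isSemisimple` at the quaternionic extension `ℰ′` (same chart functional). The brackets are transported from 𝔰𝔲(2) by some `eV` with `↑(eV a) = ρ₈a`.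
[cite: Balaban1987RG1, (4.15) p.284, (4.11) p.283, (4.7) p.282] -/
theorem wardSecond_recordTermsAx (k : ℕ) (v : Fin (k + 1) → ℝ) (K : ℕ) {ε₁ : ℝ} (hε₁ : 0 < ε₁)
    (hC3 : letI θ := thetaFill F a₀ ε₂₉
      letI := θ.instVβ₁; letI := θ.instVβ₂
      ContDiffAt ℝ 3 (expChart (recordTermsAx F a₀ ε₂₉ k v K) θ.ρ8) 0)
    (hN : letI θ := thetaFill F a₀ ε₂₉
      ∀ (w : GaugeTransf (F.P K) (k + 1) (SU 2)) (W : GaugeField (F.P K) (k + 1) (SU 2)), PlaqSmall ε₁ W →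
        mergedTermT F 2 (TβOfRecord₁₃ F 2) (chiβOfRecord₁₃Ax F 2 θ) θ.εbg K (T4FlagMemory.extd v) k (gaugeAct w W) =
          mergedTermT F 2 (TβOfRecord₁₃ F 2) (chiβOfRecord₁₃Ax F 2 θ) θ.εbg K (T4FlagMemory.extd v) k W) :
    letI θ := thetaFill F a₀ ε₂₉
    letI := θ.instVβ₁; letI := θ.instVβ₂
    ∃ eV : θ.Vβ ≃ₗ[ℝ] su (Fin 2), (∀ a, ((eV a : su (Fin 2)) : MatA 2) = θ.ρ8 a) ∧
      ∀ (u w : recordW F a₀ ε₂₉ k K) (lam : Site (F.P K) (k + 1) → θ.Vβ),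
        fderiv ℝ (fderiv ℝ (fderiv ℝ (expChart (recordTermsAx F a₀ ε₂₉ k v K) θ.ρ8))) 0 u w
            (fun ν y => lam (y + siteOfInt F K (k + 1) (unitVec (Fin.cast (F.P_d K) ν))) - lam y)
          - fderiv ℝ (fderiv ℝ (expChart (recordTermsAx F a₀ ε₂₉ k v K) θ.ρ8)) 0 u
              (fun ν x => eV.symm ⁅eV (lam x), eV (w ν x)⁆ -
                (2 : ℝ)⁻¹ • eV.symm ⁅eV (w ν x), eV (lam (x + siteOfInt F K (k + 1) (unitVec (Fin.cast (F.P_d K) ν))) - lam x)⁆)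
          - fderiv ℝ (fderiv ℝ (expChart (recordTermsAx F a₀ ε₂₉ k v K) θ.ρ8)) 0 w
              (fun ν x => eV.symm ⁅eV (lam x), eV (u ν x)⁆ -
                (2 : ℝ)⁻¹ • eV.symm ⁅eV (u ν x), eV (lam (x + siteOfInt F K (k + 1) (unitVec (Fin.cast (F.P_d K) ν))) - lam x)⁆) = 0 := by
  letI θ := thetaFill F a₀ ε₂₉; letI := θ.instVβ₁; letI := θ.instVβ₂
  haveI : FiniteDimensional ℝ θ.Vβ := show FiniteDimensional ℝ (Fin (suChartDim 2) → ℝ) from inferInstance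
  obtain ⟨eV, heV, hρ⟩ := exists_lieEquiv_su_thetaFill F a₀ ε₂₉
  obtain ⟨ℰ', h1, h2, h3⟩ := exists_ambient_extension_recordTermsAx F a₀ ε₂₉ k v K hε₁ hN
  refine ⟨eV, heV, fun u w lam => ?_⟩
  have h := third_chart_apply_grad_eq_zero_of_isSemisimple eV (fun ν => siteOfInt F K (k + 1) (unitVec (Fin.cast (F.P_d K) ν))) θ.ρ8 hρ (h2 3 hC3)
    (fun lam' => (h3 lam').mono fun W hW => Filter.Eventually.of_forall fun t => hW t) u w lam
  have hchart : (fun B : recordW F a₀ ε₂₉ k K => ℰ' (fun ν x => exp (θ.ρ8 (B ν x)))) = expChart (recordTermsAx F a₀ ε₂₉ k v K) θ.ρ8 := by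
    rw [← h1]; rfl
  rw [hchart] at h
  exact h

/-- **★ p. 289 «⟨𝐄^{(2)}, R(v)B, R(v)B⟩ = ⟨𝐄^{(2)}, B, B⟩», INFINITESIMAL FORM, AT THE RECORD**: `D²f(0)(u, [l, w]) + D²f(0)(w, [l, u]) = 0` for the record's chart, every constant `l` and
all directions `u, w` (brackets transported from 𝔰𝔲(2)). [cite: Balaban1987RG1, (4.32)-(4.33) p.289, (4.15) p.284] -/
theorem hessian_recordTermsAx_ad_invariant (k : ℕ) (v : Fin (k + 1) → ℝ) (K : ℕ) {ε₁ : ℝ} (hε₁ : 0 < ε₁)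
    (hC3 : letI θ := thetaFill F a₀ ε₂₉
      letI := θ.instVβ₁; letI := θ.instVβ₂
      ContDiffAt ℝ 3 (expChart (recordTermsAx F a₀ ε₂₉ k v K) θ.ρ8) 0)
    (hN : letI θ := thetaFill F a₀ ε₂₉
      ∀ (w : GaugeTransf (F.P K) (k + 1) (SU 2)) (W : GaugeField (F.P K) (k + 1) (SU 2)), PlaqSmall ε₁ W →
        mergedTermT F 2 (TβOfRecord₁₃ F 2) (chiβOfRecord₁₃Ax F 2 θ) θ.εbg K (T4FlagMemory.extd v) k (gaugeAct w W) =
          mergedTermT F 2 (TβOfRecord₁₃ F 2) (chiβOfRecord₁₃Ax F 2 θ) θ.εbg K (T4FlagMemory.extd v) k W) :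
    letI θ := thetaFill F a₀ ε₂₉
    letI := θ.instVβ₁; letI := θ.instVβ₂
    ∃ eV : θ.Vβ ≃ₗ[ℝ] su (Fin 2), (∀ a, ((eV a : su (Fin 2)) : MatA 2) = θ.ρ8 a) ∧
      ∀ (l : θ.Vβ) (u w : recordW F a₀ ε₂₉ k K),
        fderiv ℝ (fderiv ℝ (expChart (recordTermsAx F a₀ ε₂₉ k v K) θ.ρ8)) 0 u (fun ν x => eV.symm ⁅eV l, eV (w ν x)⁆) +
          fderiv ℝ (fderiv ℝ (expChart (recordTermsAx F a₀ ε₂₉ k v K) θ.ρ8)) 0 w (fun ν x => eV.symm ⁅eV l, eV (u ν x)⁆) = 0 := by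
  letI θ := thetaFill F a₀ ε₂₉; letI := θ.instVβ₁; letI := θ.instVβ₂
  haveI : FiniteDimensional ℝ θ.Vβ := show FiniteDimensional ℝ (Fin (suChartDim 2) → ℝ) from inferInstance
  obtain ⟨eV, heV, hρ⟩ := exists_lieEquiv_su_thetaFill F a₀ ε₂₉
  obtain ⟨ℰ', h1, h2, h3⟩ := exists_ambient_extension_recordTermsAx F a₀ ε₂₉ k v K hε₁ hN
  refine ⟨eV, heV, fun l u w => ?_⟩
  have h := hessian_chart_ad_invariant_of_isSemisimple eV (fun ν => siteOfInt F K (k + 1) (unitVec (Fin.cast (F.P_d K) ν))) θ.ρ8 hρ (h2 3 hC3)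
    (fun lam' => (h3 lam').mono fun W hW => Filter.Eventually.of_forall fun t => hW t) l u w
  have hchart : (fun B : recordW F a₀ ε₂₉ k K => ℰ' (fun ν x => exp (θ.ρ8 (B ν x)))) = expChart (recordTermsAx F a₀ ε₂₉ k v K) θ.ρ8 := by
    rw [← h1]; rfl
  rw [hchart] at h
  exact h

/-- **★★ (4.32)–(4.34) AT THE RE-CENTRED RECORD, THE LINEAGE'S FORM**: the Hessian of the record's chart at `0` is `Σ_{μ,x,ν,y} κ(eV u_μ(x), eV w_ν(y)) · E_{μν}(x, y)` for ONE scalar kernel `E`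
(κ the Killing form of 𝔰𝔲(2)) — `B12Schur433.hessian_chart_eq_sum_scalar_kernel_killing` at the quaternionic extension, the scalar centroid of 𝔰𝔲(2) supplied by
`exists_eq_smul_of_centroid_of_killing_neg` + `isSimple_su` + `killingForm_su_apply_self_neg`. [cite: Balaban1987RG1, (4.32)-(4.34) p.289, (1.21) p.264] -/
theorem hessian_recordTermsAx_eq_sum_scalar_kernel (k : ℕ) (v : Fin (k + 1) → ℝ) (K : ℕ) {ε₁ : ℝ} (hε₁ : 0 < ε₁)
    (hC3 : letI θ := thetaFill F a₀ ε₂₉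
      letI := θ.instVβ₁; letI := θ.instVβ₂
      ContDiffAt ℝ 3 (expChart (recordTermsAx F a₀ ε₂₉ k v K) θ.ρ8) 0)
    (hN : letI θ := thetaFill F a₀ ε₂₉
      ∀ (w : GaugeTransf (F.P K) (k + 1) (SU 2)) (W : GaugeField (F.P K) (k + 1) (SU 2)), PlaqSmall ε₁ W →
        mergedTermT F 2 (TβOfRecord₁₃ F 2) (chiβOfRecord₁₃Ax F 2 θ) θ.εbg K (T4FlagMemory.extd v) k (gaugeAct w W) =
          mergedTermT F 2 (TβOfRecord₁₃ F 2) (chiβOfRecord₁₃Ax F 2 θ) θ.εbg K (T4FlagMemory.extd v) k W) :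
    letI θ := thetaFill F a₀ ε₂₉
    letI := θ.instVβ₁; letI := θ.instVβ₂
    ∃ eV : θ.Vβ ≃ₗ[ℝ] su (Fin 2), (∀ a, ((eV a : su (Fin 2)) : MatA 2) = θ.ρ8 a) ∧
      ∃ E : Fin (F.P K).d → Site (F.P K) (k + 1) → Fin (F.P K).d → Site (F.P K) (k + 1) → ℝ, ∀ u w : recordW F a₀ ε₂₉ k K,
        fderiv ℝ (fderiv ℝ (expChart (recordTermsAx F a₀ ε₂₉ k v K) θ.ρ8)) 0 u w =
          ∑ μ, ∑ x, ∑ ν, ∑ y, killingForm ℝ (su (Fin 2)) (eV (u μ x)) (eV (w ν y)) • E μ x ν y := by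
  letI θ := thetaFill F a₀ ε₂₉; letI := θ.instVβ₁; letI := θ.instVβ₂
  haveI : FiniteDimensional ℝ θ.Vβ := show FiniteDimensional ℝ (Fin (suChartDim 2) → ℝ) from inferInstance
  haveI := Literature.Algebra.Lie.SpecialUnitarySimple.isSimple_su (Fin 2) (by simp)
  obtain ⟨eV, heV, hρ⟩ := exists_lieEquiv_su_thetaFill F a₀ ε₂₉
  obtain ⟨ℰ', h1, h2, h3⟩ := exists_ambient_extension_recordTermsAx F a₀ ε₂₉ k v K hε₁ hN
  refine ⟨eV, heV, ?_⟩
  obtain ⟨E, hE⟩ := Literature.MathematicalPhysics.QuantumFieldTheory.Balaban1983to89.B12Schur433.hessian_chart_eq_sum_scalar_kernel_killing eV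
    (fun ν => siteOfInt F K (k + 1) (unitVec (Fin.cast (F.P_d K) ν))) θ.ρ8 hρ (h2 3 hC3)
    (fun lam' => (h3 lam').mono fun W hW => Filter.Eventually.of_forall fun t => hW t)
    (fun φ hφ => Literature.MathematicalPhysics.QuantumFieldTheory.Balaban1983to89.B12Schur433.exists_eq_smul_of_centroid_of_killing_neg
      (fun _ hx => Literature.Algebra.Lie.CompactKillingForm.killingForm_su_apply_self_neg hx) φ hφ)
  refine ⟨E, fun u w => ?_⟩
  have hchart : (fun B : recordW F a₀ ε₂₉ k K => ℰ' (fun ν x => exp (θ.ρ8 (B ν x)))) = expChart (recordTermsAx F a₀ ε₂₉ k v K) θ.ρ8 := by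
    rw [← h1]; rfl
  have h := hE u w
  rw [hchart] at h
  exact h

end Summit.QuantumFields.YangMills.Theorems.BalabanUVNodesPortS1

end
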